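import Summits.Ventures.YMGap.FlowData.RectTubeVacuumSector
import Literature.Analysis.OperatorTheory.PositiveKernelNormLogConvex
import HarnessLib

/-!
# Venture YMGap, track Y3 FLOW-DATA — `J ↦ log ‖T_J‖` is LIPSCHITZ with constant `n·(#P + N)` on every rectangular tube
# (monotonicity of positive-kernel norms in the kernel; theorems only)

HONEST FRAMING: venture file of the cell `pub-ymgap` (QuantumFields programme), track Y3; FINITE rectangular torus, compact
group, continuous unitary `ρ` of dimension `n`; a second CROSS-β CONSISTENCY relation for the FLOW-TABLE's O0 quantity
`ln ‖T_β‖` (every chord slope lies in `[−(#P+N), #P+N]` for `SU(2)`), companion of the convexity file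
`RectTubeLogNormConvexity`.  No number, no row, nothing about `L → ∞`, the continuum or a mass gap.

THE ARGUMENT.  `|mag| ≤ n·#P`, `|elec| ≤ n·N` pointwise, so for `J₀ ≤ J₁` the slice kernels satisfy
`e^{−(J₁−J₀) n (#P+N)} K_{J₁} ≤ K_{J₀}` and `e^{−(J₁−J₀) n (#P+N)} K_{J₀} ≤ K_{J₁}` pointwise; the operator norm of a positive kernel
operator is monotone in the kernel (`Literature…PositiveKernelNormLogConvex.norm_kernelOp_mono`).

* `rectSliceKernel_le_exp_mul_of_le`, `rectSliceKernel_le_exp_mul_of_le'` — the two pointwise comparisons;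
* **`abs_log_norm_rectTubeTransferOperator_sub_le`** — `|log ‖T_{J₁}‖ − log ‖T_{J₀}‖| ≤ n (#P+N) |J₁ − J₀|`;
* **`abs_log_norm_su2RectTubeTransferOperator_sub_le'`** — `SU(2)` at Wilson coupling (`J = β/2`, `n = 2`):
  `|log ‖T_{β₁}‖ − log ‖T_{β₀}‖| ≤ (#sites·k(k−1)/2 + #sites·k)·|β₁ − β₀|`.

References: K. Bogdanović, A. Peperko (2022) §1 [cite: BogdanovicPeperko2022, §1]; K. Osterwalder, E. Seiler, Ann. Phys.
110 (1978) 440 §3 [cite: OsterwalderSeilerAnnPhys1978, §3].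
-/

noncomputable section

open scoped BigOperators ENNReal
open MeasureTheory Filter Function
open Literature.MathematicalPhysics.QuantumFieldTheory Literature.Analysis.OperatorTheory
open Literature.MathematicalPhysics.QuantumLattice (RectTorusSite fundamentalRep continuous_fundamentalRep
  fundamentalRep_mem_unitaryGroup)
open Literature.Barriers.QuantumFields

namespace Summit.Ventures.YMGap.FlowData

section Slope

variable {G : Type*} [Group G] [TopologicalSpace G] [IsTopologicalGroup G] [CompactSpace G]
  [MeasurableSpace G] [BorelSpace G] [SecondCountableTopology G] {n : ℕ} (ρ : G →* Matrix (Fin n) (Fin n) ℂ)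
  {k : ℕ} {Ls : Fin k → ℕ} [∀ i, NeZero (Ls i)]

/-- **`e^{−(J₁−J₀) n (#P+N)} K_{J₁} ≤ K_{J₀}` pointwise for `J₀ ≤ J₁`** (unitary `ρ`). [folklore] -/
theorem rectSliceKernel_le_exp_mul_of_le (hρ : Continuous ρ) (hρu : ∀ g, ρ g ∈ Matrix.unitaryGroup (Fin n) ℂ)
    {J₀ J₁ : ℝ} (hJ : J₀ ≤ J₁) (a b : RectSlice Ls G) :
    Real.exp (-((J₁ - J₀) * (n * (Fintype.card (RectTorusSite Ls) * Fintype.card {p : Fin k × Fin k // p.1 < p.2} +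
        Fintype.card (RectTorusSite Ls × Fin k))))) * rectSliceKernel (Ls := Ls) ρ J₁ J₁ a b ≤
      rectSliceKernel (Ls := Ls) ρ J₀ J₀ a b ∧
    Real.exp (-((J₁ - J₀) * (n * (Fintype.card (RectTorusSite Ls) * Fintype.card {p : Fin k × Fin k // p.1 < p.2} +
        Fintype.card (RectTorusSite Ls × Fin k))))) * rectSliceKernel (Ls := Ls) ρ J₀ J₀ a b ≤
      rectSliceKernel (Ls := Ls) ρ J₁ J₁ a b := by
  set P : ℝ := (Fintype.card (RectTorusSite Ls) : ℝ) * (Fintype.card {p : Fin k × Fin k // p.1 < p.2} : ℝ) with hP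
  set N : ℝ := (Fintype.card (RectTorusSite Ls × Fin k) : ℝ) with hN
  set Δ : ℝ := J₁ - J₀ with hΔ
  have hΔ0 : 0 ≤ Δ := by rw [hΔ]; linarith
  have htr : ∀ g : G, |(ρ g).trace.re| ≤ n := fun g =>
    (Complex.abs_re_le_norm _).trans (FiniteTemperature.norm_trace_le_of_mem_unitaryGroup (hρu _))
  have hmag : ∀ c : RectSlice Ls G, |rectMagSum (Ls := Ls) ρ c| ≤ n * P := by
    intro c
    unfold rectMagSum
    refine (Finset.abs_sum_le_sum_abs _ _).trans ?_
    refine (Finset.sum_le_sum fun x _ => (Finset.abs_sum_le_sum_abs _ _).trans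
      (Finset.sum_le_sum fun p _ => htr _)).trans (le_of_eq ?_)
    simp only [Finset.sum_const, Finset.card_univ, hP]
    ring
  have helec : ∀ E : RectTorusSite Ls → G, |rectElecSum (Ls := Ls) ρ a E b| ≤ n * N := by
    intro E
    unfold rectElecSum
    refine (Finset.abs_sum_le_sum_abs _ _).trans ?_
    refine (Finset.sum_le_sum fun x _ => (Finset.abs_sum_le_sum_abs _ _).trans
      (Finset.sum_le_sum fun i _ => htr _)).trans (le_of_eq ?_)
    simp only [Finset.sum_const, Finset.card_univ, hN, Fintype.card_prod, Fintype.card_fin]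
    push_cast; ring
  -- continuity / integrability of the temporal integrand
  have hc1 : ∀ y : RectTorusSite Ls, Continuous fun E : RectTorusSite Ls → G => E y := fun y => continuous_apply y
  have hq : Continuous fun E : RectTorusSite Ls → G => rectElecSum (Ls := Ls) ρ a E b := by
    unfold rectElecSum
    refine continuous_finsetSum _ fun x _ => continuous_finsetSum _ fun i _ => ?_
    exact (Complex.continuous_re.comp (Continuous.matrix_trace hρ)).comp
      ((((hc1 x).mul continuous_const).mul (hc1 _).inv).mul continuous_const)
  have hEi : ∀ J : ℝ, Integrable (fun E : RectTorusSite Ls → G => Real.exp (J * rectElecSum (Ls := Ls) ρ a E b))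
      (Measure.pi fun _ : RectTorusSite Ls => haarProbability G) := fun J =>
    (Real.continuous_exp.comp (continuous_const.mul hq)).integrable_of_hasCompactSupport (HasCompactSupport.of_compactSpace _)
  -- the comparisons of the three factors
  have hm : ∀ (c : RectSlice Ls G) (J J' : ℝ), J ≤ J' →
      Real.exp (-((J' - J) * (n * P) / 2)) * Real.exp (J' / 2 * rectMagSum (Ls := Ls) ρ c) ≤
        Real.exp (J / 2 * rectMagSum (Ls := Ls) ρ c) ∧
      Real.exp (-((J' - J) * (n * P) / 2)) * Real.exp (J / 2 * rectMagSum (Ls := Ls) ρ c) ≤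
        Real.exp (J' / 2 * rectMagSum (Ls := Ls) ρ c) := by
    intro c J J' hJJ
    have h := abs_le.1 (hmag c)
    constructor <;>
    · rw [← Real.exp_add]
      refine Real.exp_le_exp.2 ?_
      nlinarith [h.1, h.2]
  have hI : ∀ J J' : ℝ, J ≤ J' →
      Real.exp (-((J' - J) * (n * N))) * (∫ E, Real.exp (J' * rectElecSum (Ls := Ls) ρ a E b)
        ∂Measure.pi fun _ : RectTorusSite Ls => haarProbability G) ≤
        (∫ E, Real.exp (J * rectElecSum (Ls := Ls) ρ a E b) ∂Measure.pi fun _ : RectTorusSite Ls => haarProbability G) ∧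
      Real.exp (-((J' - J) * (n * N))) * (∫ E, Real.exp (J * rectElecSum (Ls := Ls) ρ a E b)
        ∂Measure.pi fun _ : RectTorusSite Ls => haarProbability G) ≤
        (∫ E, Real.exp (J' * rectElecSum (Ls := Ls) ρ a E b) ∂Measure.pi fun _ : RectTorusSite Ls => haarProbability G) := by
    intro J J' hJJ
    constructor <;>
    · rw [← integral_const_mul]
      refine integral_mono ((hEi _).const_mul _) (hEi _) fun E => ?_
      have h := abs_le.1 (helec E)
      dsimp only
      rw [← Real.exp_add]
      refine Real.exp_le_exp.2 ?_
      nlinarith [h.1, h.2]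
  have hK : ∀ J : ℝ, rectSliceKernel (Ls := Ls) ρ J J a b =
      Real.exp (J / 2 * rectMagSum (Ls := Ls) ρ a) *
        (∫ E, Real.exp (J * rectElecSum (Ls := Ls) ρ a E b) ∂Measure.pi fun _ : RectTorusSite Ls => haarProbability G) *
        Real.exp (J / 2 * rectMagSum (Ls := Ls) ρ b) := fun J => rfl
  have hsplit : Real.exp (-(Δ * (n * (P + N)))) =
      Real.exp (-(Δ * (n * P) / 2)) * Real.exp (-(Δ * (n * N))) * Real.exp (-(Δ * (n * P) / 2)) := by
    rw [← Real.exp_add, ← Real.exp_add]; congr 1; ring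
  have hI0 : ∀ J : ℝ, 0 ≤ ∫ E, Real.exp (J * rectElecSum (Ls := Ls) ρ a E b)
      ∂Measure.pi fun _ : RectTorusSite Ls => haarProbability G := fun J => integral_nonneg fun E => (Real.exp_pos _).le
  rw [hK, hK, hsplit]
  constructor
  · calc Real.exp (-(Δ * (n * P) / 2)) * Real.exp (-(Δ * (n * N))) * Real.exp (-(Δ * (n * P) / 2)) *
          (Real.exp (J₁ / 2 * rectMagSum ρ a) *
            (∫ E, Real.exp (J₁ * rectElecSum ρ a E b) ∂Measure.pi fun _ => haarProbability G) *
            Real.exp (J₁ / 2 * rectMagSum ρ b))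
        = (Real.exp (-(Δ * (n * P) / 2)) * Real.exp (J₁ / 2 * rectMagSum ρ a)) *
          (Real.exp (-(Δ * (n * N))) * ∫ E, Real.exp (J₁ * rectElecSum ρ a E b) ∂Measure.pi fun _ => haarProbability G) *
          (Real.exp (-(Δ * (n * P) / 2)) * Real.exp (J₁ / 2 * rectMagSum ρ b)) := by ring
      _ ≤ Real.exp (J₀ / 2 * rectMagSum ρ a) *
          (∫ E, Real.exp (J₀ * rectElecSum ρ a E b) ∂Measure.pi fun _ => haarProbability G) *
          Real.exp (J₀ / 2 * rectMagSum ρ b) :=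
        mul_le_mul (mul_le_mul (hm a J₀ J₁ hJ).1 (hI J₀ J₁ hJ).1 (by positivity) (Real.exp_pos _).le)
          (hm b J₀ J₁ hJ).1 (by positivity) (mul_nonneg (Real.exp_pos _).le (hI0 _))
  · calc Real.exp (-(Δ * (n * P) / 2)) * Real.exp (-(Δ * (n * N))) * Real.exp (-(Δ * (n * P) / 2)) *
          (Real.exp (J₀ / 2 * rectMagSum ρ a) *
            (∫ E, Real.exp (J₀ * rectElecSum ρ a E b) ∂Measure.pi fun _ => haarProbability G) *
            Real.exp (J₀ / 2 * rectMagSum ρ b))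
        = (Real.exp (-(Δ * (n * P) / 2)) * Real.exp (J₀ / 2 * rectMagSum ρ a)) *
          (Real.exp (-(Δ * (n * N))) * ∫ E, Real.exp (J₀ * rectElecSum ρ a E b) ∂Measure.pi fun _ => haarProbability G) *
          (Real.exp (-(Δ * (n * P) / 2)) * Real.exp (J₀ / 2 * rectMagSum ρ b)) := by ring
      _ ≤ Real.exp (J₁ / 2 * rectMagSum ρ a) *
          (∫ E, Real.exp (J₁ * rectElecSum ρ a E b) ∂Measure.pi fun _ => haarProbability G) *
          Real.exp (J₁ / 2 * rectMagSum ρ b) :=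
        mul_le_mul (mul_le_mul (hm a J₀ J₁ hJ).2 (hI J₀ J₁ hJ).2 (by positivity) (Real.exp_pos _).le)
          (hm b J₀ J₁ hJ).2 (by positivity) (mul_nonneg (Real.exp_pos _).le (hI0 _))

/-- **`|log ‖T_{J₁}‖ − log ‖T_{J₀}‖| ≤ n (#P+N) |J₁ − J₀|`**: the log-norm of the transfer operator is Lipschitz in the
coupling (monotonicity of positive-kernel norms in the kernel). [cite: BogdanovicPeperko2022, §1] -/
theorem abs_log_norm_rectTubeTransferOperator_sub_le (hρ : Continuous ρ) (hρu : ∀ g, ρ g ∈ Matrix.unitaryGroup (Fin n) ℂ)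
    (J₀ J₁ : ℝ) :
    |Real.log ‖rectTubeTransferOperator ρ J₁ Ls‖ - Real.log ‖rectTubeTransferOperator ρ J₀ Ls‖| ≤
      n * (Fintype.card (RectTorusSite Ls) * Fintype.card {p : Fin k × Fin k // p.1 < p.2} +
        Fintype.card (RectTorusSite Ls × Fin k)) * |J₁ - J₀| := by
  -- WLOG by symmetry of the statement in `J₀ ↔ J₁`
  set c : ℝ := n * (Fintype.card (RectTorusSite Ls) * Fintype.card {p : Fin k × Fin k // p.1 < p.2} +
        Fintype.card (RectTorusSite Ls × Fin k)) with hc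
  have hc0 : 0 ≤ c := by rw [hc]; positivity
  -- the one-sided statement for ordered couplings
  have key : ∀ J J' : ℝ, J ≤ J' →
      Real.log ‖rectTubeTransferOperator ρ J' Ls‖ - Real.log ‖rectTubeTransferOperator ρ J Ls‖ ≤ c * (J' - J) ∧
      Real.log ‖rectTubeTransferOperator ρ J Ls‖ - Real.log ‖rectTubeTransferOperator ρ J' Ls‖ ≤ c * (J' - J) := by
    intro J J' hJJ
    set w : ℝ := Real.exp (-((J' - J) * c)) with hw
    have hwpos : 0 < w := Real.exp_pos _
    have hTpos : ∀ I : ℝ, 0 < ‖rectTubeTransferOperator ρ I Ls‖ := fun I => norm_rectTubeTransferOperator_pos I Ls hρ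
    -- the scaled operators have the scaled kernels
    have hsm : ∀ (I : ℝ) (φ : Lp ℝ 2 (rectSliceMeasure G Ls)),
        ((w • rectTubeTransferOperator ρ I Ls) φ : RectSlice Ls G → ℝ) =ᵐ[rectSliceMeasure G Ls]
          fun x => ∫ y, (w * rectSliceKernel (Ls := Ls) ρ I I x y) * φ y ∂(rectSliceMeasure G Ls) := by
      intro I φ
      filter_upwards [Lp.coeFn_smul w (rectTubeTransferOperator ρ I Ls φ), rectTubeTransferOperator_ae_eq I Ls hρ φ]
        with x hx hT
      rw [_root_.smul_apply, hx, Pi.smul_apply, hT, smul_eq_mul, ← integral_const_mul]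
      refine integral_congr_ae (Eventually.of_forall fun y => ?_)
      ring
    have hKm : ∀ I : ℝ, StronglyMeasurable (uncurry fun x y => w * rectSliceKernel (Ls := Ls) ρ I I x y) := fun I =>
      stronglyMeasurable_const.mul (stronglyMeasurable_uncurry_rectSliceKernel ρ hρ I I)
    have hKb : ∀ I : ℝ, ∃ C, ∀ x y, ‖w * rectSliceKernel (Ls := Ls) ρ I I x y‖ ≤ C := by
      intro I
      obtain ⟨C, hC⟩ := exists_rectSliceKernel_le (Ls := Ls) ρ hρ I I
      refine ⟨‖w‖ * C, fun x y => ?_⟩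
      rw [norm_mul]
      exact mul_le_mul_of_nonneg_left (hC x y) (norm_nonneg _)
    have hpt := fun x y => rectSliceKernel_le_exp_mul_of_le ρ (Ls := Ls) hρ hρu hJJ x y
    obtain ⟨C1, hC1⟩ := hKb J'
    obtain ⟨C0, hC0⟩ := hKb J
    obtain ⟨D1, hD1⟩ := exists_rectSliceKernel_le (Ls := Ls) ρ hρ J' J'
    obtain ⟨D0, hD0⟩ := exists_rectSliceKernel_le (Ls := Ls) ρ hρ J J
    have h1 : ‖w • rectTubeTransferOperator ρ J' Ls‖ ≤ ‖rectTubeTransferOperator ρ J Ls‖ :=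
      norm_kernelOp_mono (μ := rectSliceMeasure G Ls) (stronglyMeasurable_uncurry_rectSliceKernel ρ hρ J J) hD0 (hKm J') hC1
        (fun x y => mul_nonneg hwpos.le (rectSliceKernel_pos ρ hρ J' J' x y).le)
        (fun x y => by rw [hw, hc]; exact (hpt x y).1)
        (rectTubeTransferOperator_ae_eq J Ls hρ) (hsm J')
    have h2 : ‖w • rectTubeTransferOperator ρ J Ls‖ ≤ ‖rectTubeTransferOperator ρ J' Ls‖ :=
      norm_kernelOp_mono (μ := rectSliceMeasure G Ls) (stronglyMeasurable_uncurry_rectSliceKernel ρ hρ J' J') hD1 (hKm J) hC0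
        (fun x y => mul_nonneg hwpos.le (rectSliceKernel_pos ρ hρ J J x y).le)
        (fun x y => by rw [hw, hc]; exact (hpt x y).2)
        (rectTubeTransferOperator_ae_eq J' Ls hρ) (hsm J)
    rw [norm_smul, Real.norm_eq_abs, abs_of_pos hwpos] at h1 h2
    have hl1 := Real.log_le_log (mul_pos hwpos (hTpos J')) h1
    have hl2 := Real.log_le_log (mul_pos hwpos (hTpos J)) h2
    rw [Real.log_mul hwpos.ne' (hTpos _).ne', hw, Real.log_exp] at hl1 hl2
    constructor <;> linarith
  rcases le_total J₀ J₁ with h | h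
  · have hk := key J₀ J₁ h
    rw [abs_of_nonneg (sub_nonneg.2 h)]
    rw [abs_le]; constructor <;> nlinarith [hk.1, hk.2]
  · have hk := key J₁ J₀ h
    rw [abs_of_nonpos (sub_nonpos.2 h)]
    rw [abs_le]; constructor <;> nlinarith [hk.1, hk.2]

end Slope

section SU2

variable {k : ℕ}

/-- **The `SU(2)` tube: `|log ‖T_{β₁}‖ − log ‖T_{β₀}‖| ≤ (#sites·k(k−1)/2 + #sites·k)·|β₁ − β₀|`** (`J = β/2`, `n = 2`): every
chord of the FLOW-TABLE's `ln ‖T‖` column has slope in `[−(#P+N), #P+N]`.  Finite volume only. [folklore] -/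
theorem abs_log_norm_su2RectTubeTransferOperator_sub_le' (Ls : Fin k → ℕ) [∀ i, NeZero (Ls i)] (β₀ β₁ : ℝ) :
    |Real.log ‖rectTubeTransferOperator (fundamentalRep (Fin 2)) (β₁ / 2) Ls‖ -
        Real.log ‖rectTubeTransferOperator (fundamentalRep (Fin 2)) (β₀ / 2) Ls‖| ≤
      (Fintype.card (RectTorusSite Ls) * Fintype.card {p : Fin k × Fin k // p.1 < p.2} +
        Fintype.card (RectTorusSite Ls × Fin k)) * |β₁ - β₀| := by
  haveI : SecondCountableTopology (Matrix.specialUnitaryGroup (Fin 2) ℂ) :=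
    Literature.MathematicalPhysics.QuantumLattice.secondCountableTopology_su2
  have h := abs_log_norm_rectTubeTransferOperator_sub_le (fundamentalRep (Fin 2)) (Ls := Ls)
    (continuous_fundamentalRep (Fin 2)) fundamentalRep_mem_unitaryGroup (β₀ / 2) (β₁ / 2)
  have h2 : |β₁ / 2 - β₀ / 2| = |β₁ - β₀| / 2 := by
    rw [← sub_div, abs_div, abs_two]
  rw [h2] at h
  push_cast at h
  linarith

end SU2

end Summit.Ventures.YMGap.FlowData
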